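import Literature.Computability.AlgebraicComplexity.TensorRestrictionRank
import Literature.Computability.AlgebraicComplexity.AsymptoticRankMatMul
import HarnessLib

/-!
# `ω = inf_{q ≥ 2} log_q R(⟨q,q,q⟩)`: the tree's exponent is the one DEFINED in
Alman–Duan–Vassilevska Williams–Xu–Xu–Zhou 2025, §3.4 — proved

Topic `Literature/Computability/AlgebraicComplexity`.  §3.4 of Alman–Duan–Vassilevska Williams–Xu–
Xu–Zhou, *More asymmetry yields faster matrix multiplication* (SODA 2025, arXiv:2404.16349), whose
record `ω ≤ 2.371339` the tree vendors as `advxxz2025_omega_le : omega ℂ ≤ 2.371339`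
(`RectangularExponent.lean`), DEFINES the exponent by

> "for any integer `q ≥ 2`, if `R(⟨q,q,q⟩) ≤ r`, then one can use the rank decomposition of `⟨q,q,q⟩`
> to design an arithmetic circuit of size `O(n^{log_q(r)})` … This motivates the definition of the
> matrix multiplication exponent `ω` as follows: `ω := inf_{q ∈ ℕ, q ≥ 2} log_q (R(⟨q,q,q⟩))`.
> … equivalently `ω` can be written in terms of the asymptotic rank of `⟨q,q,q⟩` as
> `ω = log_q (R̃(⟨q,q,q⟩))`."

The tree's `omega K = inf {β | R(⟨n,n,n⟩) = O(n^β)}` (`MatrixMultiplicationExponent.lean`, BCS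
Def. 15.1 in rank form) is a different expression; the second displayed formula was identified with
it in `AsymptoticRankMatMul.lean` (`advxxz2025_omega_eq_logb_asymptoticRank`).  This file PROVES the
first, the paper's actual definition, so that the vendored statement `advxxz2025_omega_le` is about
the paper's `ω` verbatim:

* `omega_le_logb_tensorRank_matMulTensor` — `ω ≤ log_q R(⟨q,q,q⟩)` for every `q ≥ 2` (Bläser 2013,
  Thm. 5.9 / BCS Prop. 15.5, the tree's discharged `Blaser2013Thm59_holds`);
* `exists_logb_tensorRank_matMulTensor_le` — for every `δ > 0` some `q ≥ 2` has
  `log_q R(⟨q,q,q⟩) ≤ ω + δ` (from `R(⟨q,q,q⟩) ≤ C_δ q^{ω+δ/2}` at a `q` with `C_δ ≤ q^{δ/2}`);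
* `advxxz2025_omega_eq_iInf_logb_tensorRank` — **`ω = inf_{q ≥ 2} log_q R(⟨q,q,q⟩)`** (as an `iInf`
  over the subtype `{q : ℕ // 2 ≤ q}`), and the set form `advxxz2025_omega_eq_sInf_logb_tensorRank`;
* `advxxz2025_omega_eq_iInf_logb_asymptoticRank` — the same infimum with `R̃` in place of `R` (every
  term of which already equals `ω`).

Everything is proved; no definitions, no named facts.

## References

* J. Alman, R. Duan, V. Vassilevska Williams, Y. Xu, Z. Xu, R. Zhou, *More asymmetry yields faster
  matrix multiplication*, SODA 2025, arXiv:2404.16349, §3.4 (the two displayed formulas for `ω`).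
  [AlmanDuanVassilevskaWilliamsXuXuZhou2025]
* M. Bläser, *Fast Matrix Multiplication*, Theory of Computing Graduate Surveys 5 (2013), Thm. 5.9
  (`R(⟨k,m,n⟩) ≤ r ⇒ ω ≤ 3 log_{kmn} r`). [Blaser2013]
* P. Bürgisser, M. Clausen, M. A. Shokrollahi, *Algebraic Complexity Theory*, Springer 1997,
  Def. 15.1, Prop. 15.5, and p. 425 ("for every `ε > 0` a constant `c_ε` such that for all `n`,
  `R(⟨n,n,n⟩) ≤ c_ε n^{ω+ε}`"). [BurgisserClausenShokrollahi1997]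
-/

noncomputable section

open Filter

namespace Literature.Computability.AlgebraicComplexity

section OmegaInf

variable (K : Type) [Field K]

/-- **`ω ≤ log_q R(⟨q,q,q⟩)` for every `q ≥ 2`** (each term of the paper's infimum bounds the
tree's `ω`; Bläser 2013, Thm. 5.9 with `r = R(⟨q,q,q⟩)`). [cite: Blaser2013, Thm. 5.9] -/
theorem omega_le_logb_tensorRank_matMulTensor {q : ℕ} (hq : 2 ≤ q) :
    omega K ≤ Real.logb q (tensorRank (matMulTensor K q q q)) :=
  omega_le_logb_of_rank_le' Blaser2013Thm59_holds K hq le_rfl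

/-- `R(⟨q,q,q⟩) > 0` for `q ≥ 2` (indeed `≥ q² ≥ 4`, flattening). [folklore] -/
theorem tensorRank_matMulTensor_pos {q : ℕ} (hq : 2 ≤ q) :
    (0 : ℝ) < tensorRank (matMulTensor K q q q) := by
  have h := matMulTensor_sq_le_tensorRank K q
  have h4 : 4 ≤ q ^ 2 := by nlinarith
  exact_mod_cast lt_of_lt_of_le (by norm_num) (h4.trans h)

/-- **The infimum is approached**: for every `δ > 0` there is `q ≥ 2` with
`log_q R(⟨q,q,q⟩) ≤ ω + δ` — since `R(⟨q,q,q⟩) ≤ C_δ q^{ω + δ/2}` for all `q` (BCS p. 425), any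
`q ≥ 2` with `C_δ ≤ q^{δ/2}` will do. [cite: BurgisserClausenShokrollahi1997, §15.5 (p. 425)] -/
theorem exists_logb_tensorRank_matMulTensor_le {δ : ℝ} (hδ : 0 < δ) :
    ∃ q : ℕ, 2 ≤ q ∧ Real.logb q (tensorRank (matMulTensor K q q q)) ≤ omega K + δ := by
  obtain ⟨C, hC, hb⟩ := exists_tensorRank_matMulTensor_le_rpow K (half_pos hδ)
  set q : ℕ := max 2 ⌈C ^ (2 / δ)⌉₊ with hqdef
  have hq2 : 2 ≤ q := le_max_left _ _
  refine ⟨q, hq2, ?_⟩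
  have hq1 : (1 : ℝ) < q := by exact_mod_cast (lt_of_lt_of_le (by norm_num) hq2)
  have hq0 : (0 : ℝ) < q := by linarith
  have hR := hb q (by omega)
  -- `C ≤ q^{δ/2}`
  have hCq : C ≤ (q : ℝ) ^ (δ / 2) := by
    have h1 : C ^ (2 / δ) ≤ (q : ℝ) :=
      (Nat.le_ceil _).trans (by exact_mod_cast le_max_right 2 ⌈C ^ (2 / δ)⌉₊)
    have h2 : (C ^ (2 / δ)) ^ (δ / 2) ≤ (q : ℝ) ^ (δ / 2) :=
      Real.rpow_le_rpow (by positivity) h1 (by positivity)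
    have e : (C ^ (2 / δ)) ^ (δ / 2) = C := by
      rw [← Real.rpow_mul hC.le]
      have : 2 / δ * (δ / 2) = 1 := by field_simp
      rw [this, Real.rpow_one]
    rwa [e] at h2
  rw [Real.logb_le_iff_le_rpow hq1 (tensorRank_matMulTensor_pos K hq2)]
  calc (tensorRank (matMulTensor K q q q) : ℝ) ≤ C * (q : ℝ) ^ (omega K + δ / 2) := hR
    _ ≤ (q : ℝ) ^ (δ / 2) * (q : ℝ) ^ (omega K + δ / 2) :=
        mul_le_mul_of_nonneg_right hCq (Real.rpow_nonneg hq0.le _)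
    _ = (q : ℝ) ^ (omega K + δ) := by
        rw [← Real.rpow_add hq0]
        ring_nf

/-- The family `q ↦ log_q R(⟨q,q,q⟩)`, `q ≥ 2`, is bounded below (by `ω`). [folklore] -/
theorem bddBelow_range_logb_tensorRank_matMulTensor :
    BddBelow (Set.range fun q : {q : ℕ // 2 ≤ q} =>
      Real.logb q (tensorRank (matMulTensor K q q q))) := by
  refine ⟨omega K, ?_⟩
  rintro _ ⟨q, rfl⟩
  exact omega_le_logb_tensorRank_matMulTensor K q.2

/-- **ADVXXZ 2025, §3.4, the definition of `ω`: `ω = inf_{q ∈ ℕ, q ≥ 2} log_q R(⟨q,q,q⟩)`** — the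
tree's `omega K` (infimum of the admissible exponents `{β | R(⟨n,n,n⟩) = O(n^β)}`) IS the exponent
the paper defines (infimum over the subtype of integers `q ≥ 2`).
[cite: AlmanDuanVassilevskaWilliamsXuXuZhou2025, §3.4 (definition of ω)] -/
theorem advxxz2025_omega_eq_iInf_logb_tensorRank :
    omega K = ⨅ q : {q : ℕ // 2 ≤ q}, Real.logb q (tensorRank (matMulTensor K q q q)) := by
  haveI : Nonempty {q : ℕ // 2 ≤ q} := ⟨⟨2, le_rfl⟩⟩
  refine le_antisymm (le_ciInf fun q => omega_le_logb_tensorRank_matMulTensor K q.2) ?_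
  refine le_of_forall_pos_le_add fun δ hδ => ?_
  obtain ⟨q, hq, h⟩ := exists_logb_tensorRank_matMulTensor_le K hδ
  exact (ciInf_le (bddBelow_range_logb_tensorRank_matMulTensor K) ⟨q, hq⟩).trans h

/-- The same in set form: `ω = inf {log_q R(⟨q,q,q⟩) | q ∈ ℕ, q ≥ 2}`.
[cite: AlmanDuanVassilevskaWilliamsXuXuZhou2025, §3.4 (definition of ω)] -/
theorem advxxz2025_omega_eq_sInf_logb_tensorRank :
    omega K = sInf {x : ℝ | ∃ q : ℕ, 2 ≤ q ∧ x = Real.logb q (tensorRank (matMulTensor K q q q))} := by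
  rw [advxxz2025_omega_eq_iInf_logb_tensorRank K, iInf, Set.range]
  congr 1
  ext x
  simp only [Set.mem_setOf_eq, Subtype.exists, exists_prop]
  constructor
  · rintro ⟨q, hq, rfl⟩
    exact ⟨q, hq, rfl⟩
  · rintro ⟨q, hq, rfl⟩
    exact ⟨q, hq, rfl⟩

/-- Every term of the paper's infimum is a genuine upper bound: `R(⟨q,q,q⟩) ≤ r`, `q ≥ 2` ⇒
`ω ≤ log_q r` (e.g. Strassen: `R(⟨2,2,2⟩) ≤ 7 ⇒ ω ≤ log₂ 7`) — the sentence motivating the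
definition. [cite: AlmanDuanVassilevskaWilliamsXuXuZhou2025, §3.4] -/
theorem advxxz2025_omega_le_logb_of_tensorRank_le {q r : ℕ} (hq : 2 ≤ q)
    (hr : tensorRank (matMulTensor K q q q) ≤ r) : omega K ≤ Real.logb q r :=
  omega_le_logb_of_rank_le' Blaser2013Thm59_holds K hq hr

/-- **ADVXXZ 2025, §3.4, second formula, uniformly in `q`**: with the asymptotic rank every term of
the infimum already equals `ω`, `ω = inf_{q ≥ 2} log_q R̃(⟨q,q,q⟩) = log_q R̃(⟨q,q,q⟩)`
(`advxxz2025_omega_eq_logb_asymptoticRank`). [cite: AlmanDuanVassilevskaWilliamsXuXuZhou2025, §3.4 (ω = log_q R̃(⟨q,q,q⟩))] -/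
theorem advxxz2025_omega_eq_iInf_logb_asymptoticRank :
    omega K = ⨅ q : {q : ℕ // 2 ≤ q}, Real.logb q (asymptoticRank (matMulTensor K q q q)) := by
  haveI : Nonempty {q : ℕ // 2 ≤ q} := ⟨⟨2, le_rfl⟩⟩
  have h : (fun q : {q : ℕ // 2 ≤ q} => Real.logb q (asymptoticRank (matMulTensor K q q q))) =
      fun _ => omega K :=
    funext fun q => (advxxz2025_omega_eq_logb_asymptoticRank K q q.2).symm
  rw [h, ciInf_const]

/-- The rank infimum dominates the asymptotic-rank terms termwise:
`log_q R̃(⟨q,q,q⟩) = ω ≤ log_q R(⟨q,q,q⟩)` (`R̃ ≤ R`). [cite: AlmanDuanVassilevskaWilliamsXuXuZhou2025, §3.2–§3.4] -/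
theorem logb_asymptoticRank_le_logb_tensorRank_matMulTensor {q : ℕ} (hq : 2 ≤ q) :
    Real.logb q (asymptoticRank (matMulTensor K q q q)) ≤
      Real.logb q (tensorRank (matMulTensor K q q q)) := by
  rw [← advxxz2025_omega_eq_logb_asymptoticRank K q hq]
  exact omega_le_logb_tensorRank_matMulTensor K hq

end OmegaInf

end Literature.Computability.AlgebraicComplexity

end
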